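import Summits.MatrixMultiplication.OmegaCensus.STPPClosureFilter

/-!
# ω-census (abelian STPP census): the two engine-decided leaves of the ℤ₅₆ record frontier are kernel-dead (N10, N12)

HONEST FRAMING (pub-omega census; verbatim): lottery ticket; floor = certified bounds/negative ranges.
Census BOOKKEEPING (seat pub-omega-stpp-1 gen 26, 2026-08-27; asked for by the lead, ruling L34-5): the OMEGA-TABLE row Pb166
(«ℤ₅₆ admits no beating STPP family — candidate; closure COMPLETE over the 149-leaf record frontier: 147 leaves kernel-dead by the Kneser
filter N8 + 2 decided by engine in kit j274066») keeps two leaves on an ENGINE verdict.  Both are theorem-dead: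
* `no_isSTPP_Z56_157_234` — `{(1,5,7), (2,3,4)}` (`Σ abc = 59 > 56`) by filter N10 (`CubeNB.not_isSTPP_of_n9Dead'`,
  `STPPRepresentationCount.lean`): in the rotation `(B,C,A)` one has `Σ|Bᵢ||Cᵢ| + Σ|Cᵢ||Aᵢ| − min|Cᵢ| = 47 + 15 − 4 = 58 > 56`;
* `no_isSTPP_Z56_113_125_271_312_423` — `{(1,1,3), (1,2,5), (2,7,1), (3,1,2), (4,2,3)}` (`Σ abc = 57 > 56`, alive under N7–N11) by filter
  N12 (`CubeNB.not_isSTPP_of_n12Dead'`, `STPPClosureFilter.lean`): identity rotation, `|X| = |Y| = |Z| = 28`, `σ = 20 > 28/2`, `σ' = 18`,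
  `V = 57`; `X − X = Y − Y` is a subgroup of order `e ∣ 56` with `e ≥ 28`: `e = 28` violates the mass inequality `28·28 ≤ 57 + 0·28`,
  `e = 56` violates the energy `55·20 + 28 ≤ 28²`.
So the 149-leaf closure of Pb166 is by KERNEL filters throughout (N8 ×147, N10 ×1, N12 ×1); the cores behind the frontier remain engine
records.  Both statements hold in ANY abelian group of order `56` (`ℤ/56`, `ℤ/2 × ℤ/28`, `(ℤ/2)² × ℤ/14`).  Nothing on `ω`.

References: H. Cohn, R. Kleinberg, B. Szegedy, C. Umans, FOCS 2005 (arXiv:math/0511460), Def. 5.1.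
-/

open Finset Literature.Computability.AlgebraicComplexity

namespace Summit.MatrixMultiplication.OmegaCensus.CubeNB

variable {H : Type*} [AddCommGroup H] [DecidableEq H] [Fintype H]

/-- No STPP family with blocks `{(1,5,7), (2,3,4)}` in an abelian group of order `56` (filter N10, rotation `(B,C,A)`:
`47 + 15 − 4 = 58 > 56`). [cite: CohnKleinbergSzegedyUmans2005, Def. 5.1] -/
theorem no_isSTPP_Z56_157_234 (hH : Fintype.card H = 56) (A B C : Fin 2 → Finset H) (hS : IsSTPP A B C)
    (hA : ∀ i, #(A i) = ![1, 2] i) (hB : ∀ i, #(B i) = ![5, 3] i) (hC : ∀ i, #(C i) = ![7, 4] i) : False :=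
  not_isSTPP_of_n9Dead' hS hH _ _ _ hA hB hC (by decide) (by decide +kernel)

/-- No STPP family with blocks `{(1,1,3), (1,2,5), (2,7,1), (3,1,2), (4,2,3)}` in an abelian group of order `56` (filter N12: `|X| = |Y| =
|Z| = 28`, `σ = 20`, `σ' = 18`, `V = 57`; no divisor `e ∈ {28, 56}` passes). [cite: CohnKleinbergSzegedyUmans2005, Def. 5.1] -/
theorem no_isSTPP_Z56_113_125_271_312_423 (hH : Fintype.card H = 56) (A B C : Fin 5 → Finset H) (hS : IsSTPP A B C)
    (hA : ∀ i, #(A i) = ![1, 1, 2, 3, 4] i) (hB : ∀ i, #(B i) = ![1, 2, 7, 1, 2] i) (hC : ∀ i, #(C i) = ![3, 5, 1, 2, 3] i) :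
    False :=
  not_isSTPP_of_n12Dead' hS hH _ _ _ hA hB hC (by decide) (by decide +kernel)

end Summit.MatrixMultiplication.OmegaCensus.CubeNB
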